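import Summits.Ventures.PackingBounds.Configurations.ListConfigTwoOrbit
import Mathlib.NumberTheory.Zsqrtd.ToReal

/-!
# Five points on `S²`: the triangular bipyramid and a square pyramid as explicit configurations

Framing: lottery ticket; floor = certified bounds/negative ranges. Venture `PackingBounds` (cell
`pub-packcert`, seat `pub-packcert-energy`) — data for `NoUniversalOptimumFive.lean` (Cohn–Kumar 2007, §1:
"[universal optimality] provably fails in the case of five points on `S²`").

* `Bipyramid.pts`: the triangular bipyramid (poles `±e₃`, equilateral triangle on the equator; coordinates in
  `ℤ[√3]/2`), `5` unit vectors with inner products `-1` (×2), `0` (×12), `-1/2` (×6):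
  `Bipyramid.energy_pts : Σ_{x ≠ y} a(⟪x,y⟫) = 2a(-1) + 12a(0) + 6a(-1/2)`, `inner_pts_le : ≤ 0`.
* `SquarePyramid.pts`: the north pole with a square at height `-4/25` (coordinates in `ℤ[√609]/25`), inner
  products `-4/25` (×8), `16/625` (×8), `-593/625` (×4) — Cohn–Kumar's competitor "a single point together with four
  points equidistant from it and forming a square in the opposite hemisphere" for `f(r) = (4-r)^7 ∝ (1+t)^7`:
  `SquarePyramid.energy_pts`; its `(1+t)^7`-energy `11.9092…` is below the bipyramid's `12 + 6/2⁷ = 12.046875`.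
Both use the two-orbit kernel checks of `ListConfigTwoOrbit.lean`.

## References
* H. Cohn, A. Kumar, *Universally optimal distribution of points on spheres*, J. Amer. Math. Soc. 20 (2007)
  99–148, §1 (p. 102: five points on `S²`). [`CohnKumar2006`]
-/

namespace Summit.Ventures.PackingBounds.Config

open Finset Summit.Ventures.PackingBounds.Config

namespace Bipyramid

/-- `0 ≤ 3`. -/
private theorem hd : (0 : ℤ) ≤ 3 := by norm_num

/-- `3` is not a square. -/
private theorem d_not_square : ∀ n : ℤ, (3 : ℤ) ≠ n * n := by
  intro n h
  have h1 : n.natAbs * n.natAbs = 3 := by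
    have := Int.natAbs_mul_self' n; omega
  have h2 : n.natAbs ≤ 2 := by nlinarith
  interval_cases n.natAbs <;> omega

/-- `(√3)² = 3`. -/
private theorem hX : Real.sqrt 3 ^ 2 = 3 := Real.sq_sqrt (by norm_num)

/-- The two poles `(0,0,±2)` (scale `2`) over `ℤ[√3]`. [cite: CohnKumar2006, §1 (five points on S²: antipodal pair + equilateral triangle)] -/
def rows₁ : List (List (Zsqrtd 3)) := [
  [⟨0, 0⟩, ⟨0, 0⟩, ⟨2, 0⟩],
  [⟨0, 0⟩, ⟨0, 0⟩, ⟨-2, 0⟩]]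

/-- The equatorial equilateral triangle `(2,0,0), (-1,±√3,0)` (scale `2`). [cite: CohnKumar2006, §1 (five points on S²: antipodal pair + equilateral triangle)] -/
def rows₂ : List (List (Zsqrtd 3)) := [
  [⟨2, 0⟩, ⟨0, 0⟩, ⟨0, 0⟩],
  [⟨-1, 0⟩, ⟨0, 1⟩, ⟨0, 0⟩],
  [⟨-1, 0⟩, ⟨0, -1⟩, ⟨0, 0⟩]]

/-- All coordinate lists (scaled). -/
def vecs : List (List (Zsqrtd 3)) := rows₁ ++ rows₂

/-- Dot-product histogram of an orbit-1 row with the other rows. -/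
def table₁ : List ((Zsqrtd 3) × ℕ) := [(⟨-4, 0⟩, 1), (⟨0, 0⟩, 3)]

/-- Dot-product histogram of an orbit-2 row with the other rows. -/
def table₂ : List ((Zsqrtd 3) × ℕ) := [(⟨-2, 0⟩, 2), (⟨0, 0⟩, 2)]

/-- Kernel check: `5` coordinate lists. -/
theorem length_vecs : vecs.length = 5 := by decide +kernel

/-- Kernel check: `2` orbit-1 rows. -/
theorem length_rows₁ : rows₁.length = 2 := by decide +kernel

/-- Kernel check: `3` orbit-2 rows. -/
theorem length_rows₂ : rows₂.length = 3 := by decide +kernel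

set_option maxRecDepth 100000 in
/-- Kernel check: every list has length `3` and squared length `4`. -/
theorem shape_vecs : shapeOK vecs 3 (⟨4, 0⟩ : (Zsqrtd 3)) = true := by decide +kernel

/-- Kernel check: orbit-1 table keys distinct and `≠ q`. -/
theorem keys_table₁ : keysOK table₁ (⟨4, 0⟩ : (Zsqrtd 3)) = true := by decide +kernel

/-- Kernel check: orbit-2 table keys distinct and `≠ q`. -/
theorem keys_table₂ : keysOK table₂ (⟨4, 0⟩ : (Zsqrtd 3)) = true := by decide +kernel

set_option maxRecDepth 100000 in
/-- Kernel check (orbit-1 distance distribution). -/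
theorem hist_rows₁ : histOK vecs table₁ rows₁ = true := by decide +kernel

set_option maxRecDepth 100000 in
/-- Kernel check (orbit-2 distance distribution). -/
theorem hist_rows₂ : histOK vecs table₂ rows₂ = true := by decide +kernel

/-- The configuration: the normalised coordinate lists as points of `ℝ³`. -/
noncomputable def pts : Finset (EuclideanSpace ℝ (Fin 3)) :=
  config (Zsqrtd.toReal hd) 3 (⟨4, 0⟩ : (Zsqrtd 3)) vecs

/-- `ι q > 0`. -/
theorem hq : 0 < (Zsqrtd.toReal hd) (⟨4, 0⟩ : (Zsqrtd 3)) := by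
  rw [Zsqrtd.toReal_apply]; push_cast; nlinarith [Real.sqrt_nonneg 3, hX]

/-- Node value `ι d / ι q` for the dot product `-4` (inner product `-1`). -/
theorem key_0 : (Zsqrtd.toReal hd) (⟨-4, 0⟩ : (Zsqrtd 3)) / (Zsqrtd.toReal hd) (⟨4, 0⟩ : (Zsqrtd 3)) = (-1 : ℝ) := by
  rw [div_eq_iff hq.ne', Zsqrtd.toReal_apply, Zsqrtd.toReal_apply]
  push_cast
  ring

/-- Node value `ι d / ι q` for the dot product `-2` (inner product `-1/2`). -/
theorem key_1 : (Zsqrtd.toReal hd) (⟨-2, 0⟩ : (Zsqrtd 3)) / (Zsqrtd.toReal hd) (⟨4, 0⟩ : (Zsqrtd 3)) = (-1 / 2 : ℝ) := by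
  rw [div_eq_iff hq.ne', Zsqrtd.toReal_apply, Zsqrtd.toReal_apply]
  push_cast
  ring

/-- Node value `ι d / ι q` for the dot product `0` (inner product `0`). -/
theorem key_2 : (Zsqrtd.toReal hd) (⟨0, 0⟩ : (Zsqrtd 3)) / (Zsqrtd.toReal hd) (⟨4, 0⟩ : (Zsqrtd 3)) = (0 : ℝ) := by
  rw [div_eq_iff hq.ne', Zsqrtd.toReal_apply, Zsqrtd.toReal_apply]
  push_cast
  ring

/-- `pts` has `5` points. -/
theorem card_pts : pts.card = 5 := by
  rw [pts, card_eq₂ (Zsqrtd.toReal_injective hd d_not_square) hq shape_vecs keys_table₁ keys_table₂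
    hist_rows₁ hist_rows₂ rfl, length_vecs]

/-- Every point of `pts` is a unit vector. -/
theorem norm_pts : ∀ x ∈ pts, ‖x‖ = 1 := norm_eq_one hq shape_vecs

/-- Distinct points of `pts` have inner product `≤ 0`. -/
theorem inner_pts_le : ∀ x ∈ pts, ∀ y ∈ pts, x ≠ y → inner ℝ x y ≤ (0 : ℝ) := by
  refine inner_le₂ hq shape_vecs hist_rows₁ hist_rows₂ rfl (0 : ℝ) fun p hp => ?_
  simp only [table₁, table₂, List.cons_append, List.nil_append, List.mem_cons, List.not_mem_nil,
    or_false] at hp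
  rcases hp with rfl | rfl | rfl | rfl <;>
    (rw [div_le_iff₀ hq, Zsqrtd.toReal_apply, Zsqrtd.toReal_apply]; push_cast; nlinarith [hX])

/-- **Energy of the configuration**: for every potential `a`, `Σ_{x ≠ y ∈ pts} a(⟪x,y⟫)` equals the tabulated value. -/
theorem energy_pts (a : ℝ → ℝ) :
    ∑ x ∈ pts, ∑ y ∈ pts.erase x, a (inner ℝ x y) =
      2 * (a (-1 : ℝ) + 3 * a 0) + 3 * (2 * a 0 + 2 * a (-1 / 2 : ℝ)) := by
  rw [pts, energy_eq₂ (Zsqrtd.toReal_injective hd d_not_square) hq shape_vecs keys_table₁ keys_table₂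
    hist_rows₁ hist_rows₂ rfl a, length_rows₁, length_rows₂]
  simp only [table₁, table₂, List.map_cons, List.map_nil, List.sum_cons, List.sum_nil, Nat.cast_ofNat,
    Nat.cast_one]
  rw [key_0, key_1, key_2]
  ring

end Bipyramid

namespace SquarePyramid

/-- `0 ≤ 609`. -/
private theorem hd : (0 : ℤ) ≤ 609 := by norm_num

/-- `609` is not a square. -/
private theorem d_not_square : ∀ n : ℤ, (609 : ℤ) ≠ n * n := by
  intro n h
  have h1 : n.natAbs * n.natAbs = 609 := by
    have := Int.natAbs_mul_self' n; omega
  have h2 : n.natAbs ≤ 24 := by nlinarith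
  interval_cases n.natAbs <;> omega

/-- `(√609)² = 609`. -/
private theorem hX : Real.sqrt 609 ^ 2 = 609 := Real.sq_sqrt (by norm_num)

/-- The apex `(0,0,25)` (scale `25`) over `ℤ[√609]`. [cite: CohnKumar2006, §1 (five points on S²: the square-pyramid competitor)] -/
def rows₁ : List (List (Zsqrtd 609)) := [
  [⟨0, 0⟩, ⟨0, 0⟩, ⟨25, 0⟩]]

/-- The square `(±√609, 0, -4), (0, ±√609, -4)` at height `-4/25` (scale `25`). [cite: CohnKumar2006, §1 (five points on S²: the square-pyramid competitor)] -/
def rows₂ : List (List (Zsqrtd 609)) := [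
  [⟨0, 1⟩, ⟨0, 0⟩, ⟨-4, 0⟩],
  [⟨0, -1⟩, ⟨0, 0⟩, ⟨-4, 0⟩],
  [⟨0, 0⟩, ⟨0, 1⟩, ⟨-4, 0⟩],
  [⟨0, 0⟩, ⟨0, -1⟩, ⟨-4, 0⟩]]

/-- All coordinate lists (scaled). -/
def vecs : List (List (Zsqrtd 609)) := rows₁ ++ rows₂

/-- Dot-product histogram of an orbit-1 row with the other rows. -/
def table₁ : List ((Zsqrtd 609) × ℕ) := [(⟨-100, 0⟩, 4)]

/-- Dot-product histogram of an orbit-2 row with the other rows. -/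
def table₂ : List ((Zsqrtd 609) × ℕ) := [(⟨-593, 0⟩, 1), (⟨-100, 0⟩, 1), (⟨16, 0⟩, 2)]

/-- Kernel check: `5` coordinate lists. -/
theorem length_vecs : vecs.length = 5 := by decide +kernel

/-- Kernel check: `1` orbit-1 rows. -/
theorem length_rows₁ : rows₁.length = 1 := by decide +kernel

/-- Kernel check: `4` orbit-2 rows. -/
theorem length_rows₂ : rows₂.length = 4 := by decide +kernel

set_option maxRecDepth 100000 in
/-- Kernel check: every list has length `3` and squared length `625`. -/
theorem shape_vecs : shapeOK vecs 3 (⟨625, 0⟩ : (Zsqrtd 609)) = true := by decide +kernel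

/-- Kernel check: orbit-1 table keys distinct and `≠ q`. -/
theorem keys_table₁ : keysOK table₁ (⟨625, 0⟩ : (Zsqrtd 609)) = true := by decide +kernel

/-- Kernel check: orbit-2 table keys distinct and `≠ q`. -/
theorem keys_table₂ : keysOK table₂ (⟨625, 0⟩ : (Zsqrtd 609)) = true := by decide +kernel

set_option maxRecDepth 100000 in
/-- Kernel check (orbit-1 distance distribution). -/
theorem hist_rows₁ : histOK vecs table₁ rows₁ = true := by decide +kernel

set_option maxRecDepth 100000 in
/-- Kernel check (orbit-2 distance distribution). -/
theorem hist_rows₂ : histOK vecs table₂ rows₂ = true := by decide +kernel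

/-- The configuration: the normalised coordinate lists as points of `ℝ³`. -/
noncomputable def pts : Finset (EuclideanSpace ℝ (Fin 3)) :=
  config (Zsqrtd.toReal hd) 3 (⟨625, 0⟩ : (Zsqrtd 609)) vecs

/-- `ι q > 0`. -/
theorem hq : 0 < (Zsqrtd.toReal hd) (⟨625, 0⟩ : (Zsqrtd 609)) := by
  rw [Zsqrtd.toReal_apply]; push_cast; nlinarith [Real.sqrt_nonneg 609, hX]

/-- Node value `ι d / ι q` for the dot product `-593` (inner product `-593/625`). -/
theorem key_0 : (Zsqrtd.toReal hd) (⟨-593, 0⟩ : (Zsqrtd 609)) / (Zsqrtd.toReal hd) (⟨625, 0⟩ : (Zsqrtd 609)) = (-593 / 625 : ℝ) := by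
  rw [div_eq_iff hq.ne', Zsqrtd.toReal_apply, Zsqrtd.toReal_apply]
  push_cast
  ring

/-- Node value `ι d / ι q` for the dot product `-100` (inner product `-4/25`). -/
theorem key_1 : (Zsqrtd.toReal hd) (⟨-100, 0⟩ : (Zsqrtd 609)) / (Zsqrtd.toReal hd) (⟨625, 0⟩ : (Zsqrtd 609)) = (-4 / 25 : ℝ) := by
  rw [div_eq_iff hq.ne', Zsqrtd.toReal_apply, Zsqrtd.toReal_apply]
  push_cast
  ring

/-- Node value `ι d / ι q` for the dot product `16` (inner product `16/625`). -/
theorem key_2 : (Zsqrtd.toReal hd) (⟨16, 0⟩ : (Zsqrtd 609)) / (Zsqrtd.toReal hd) (⟨625, 0⟩ : (Zsqrtd 609)) = (16 / 625 : ℝ) := by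
  rw [div_eq_iff hq.ne', Zsqrtd.toReal_apply, Zsqrtd.toReal_apply]
  push_cast
  ring

/-- `pts` has `5` points. -/
theorem card_pts : pts.card = 5 := by
  rw [pts, card_eq₂ (Zsqrtd.toReal_injective hd d_not_square) hq shape_vecs keys_table₁ keys_table₂
    hist_rows₁ hist_rows₂ rfl, length_vecs]

/-- Every point of `pts` is a unit vector. -/
theorem norm_pts : ∀ x ∈ pts, ‖x‖ = 1 := norm_eq_one hq shape_vecs

/-- Distinct points of `pts` have inner product `≤ 16/625`. -/
theorem inner_pts_le : ∀ x ∈ pts, ∀ y ∈ pts, x ≠ y → inner ℝ x y ≤ (16 / 625 : ℝ) := by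
  refine inner_le₂ hq shape_vecs hist_rows₁ hist_rows₂ rfl (16 / 625 : ℝ) fun p hp => ?_
  simp only [table₁, table₂, List.cons_append, List.nil_append, List.mem_cons, List.not_mem_nil,
    or_false] at hp
  rcases hp with rfl | rfl | rfl | rfl <;>
    (rw [div_le_iff₀ hq, Zsqrtd.toReal_apply, Zsqrtd.toReal_apply]; push_cast; nlinarith [hX])

/-- **Energy of the configuration**: for every potential `a`, `Σ_{x ≠ y ∈ pts} a(⟪x,y⟫)` equals the tabulated value. -/
theorem energy_pts (a : ℝ → ℝ) :
    ∑ x ∈ pts, ∑ y ∈ pts.erase x, a (inner ℝ x y) =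
      1 * (4 * a (-4 / 25 : ℝ)) + 4 * (a (-593 / 625 : ℝ) + a (-4 / 25 : ℝ) + 2 * a (16 / 625 : ℝ)) := by
  rw [pts, energy_eq₂ (Zsqrtd.toReal_injective hd d_not_square) hq shape_vecs keys_table₁ keys_table₂
    hist_rows₁ hist_rows₂ rfl a, length_rows₁, length_rows₂]
  simp only [table₁, table₂, List.map_cons, List.map_nil, List.sum_cons, List.sum_nil, Nat.cast_ofNat,
    Nat.cast_one]
  rw [key_0, key_1, key_2]
  ring

end SquarePyramid

end Summit.Ventures.PackingBounds.Config
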